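import Mathlib.AlgebraicGeometry.EllipticCurve.Affine.Point
import Mathlib.RingTheory.Polynomial.RationalRoot
import Mathlib.Tactic.ComputeDegree
import Literature.NumberTheory.EllipticCurves.MordellWeilTheoremProofs
import HarnessLib

/-!
# The curve 5077a: three independent rational points (Buhler–Gross–Zagier 1985)

The elliptic curve `E : y² + y = x³ − 7x + 6` of conductor `5077` (Buhler–Gross–Zagier 1985,
eq. (2); the curve of Gross–Zagier's application to Gauss's class number problem) carries the
rational points `P₀ = (0,2)`, `P₁ = (1,0)`, `P₂ = (2,0)`, which BGZ show generate `E(ℚ) ≅ ℤ³`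
(op. cit. §2, p. 475). This file PROVES the part of that statement which the Goldfeld–Oesterlé
chain needs: `P₀, P₁, P₂` are `ℤ`-linearly independent, hence `3 ≤ rank_ℤ E(ℚ)`
(`three_le_mordellWeilRank`), by an exact `2`-descent certificate:

* `E(ℚ)[2] = 0` (a rational `2`-torsion point would give a rational root of `u³ − 28u + 50`,
  `u = 2x`; a root is an integer by the integral root theorem and there is none modulo `3`);
* none of the seven non-empty subset sums `(0,2), (1,0), (2,0), (3,3), (−1,−4), (−3,−1), (4,−7)`
  of `P₀, P₁, P₂` is divisible by `2` in `E(ℚ)`: `2R = Q` forces `x(R)` to be a rational root of the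
  monic quartic `x⁴ − 4x_Q x³ + 14x² + (28x_Q − 50)x + (49 − 25x_Q)` (Mathlib's doubling formula),
  hence an integer, and each quartic has no root modulo `5` or `7`;
* the (private) module-theoretic lemma `linearIndependent_of_halving_obstruction`: in an abelian group without
  `2`-torsion, elements no non-empty subset sum of which is divisible by `2` are `ℤ`-independent
  (descent on `Σ |gᵢ|`).

With the Mordell–Weil theorem (tree theorem `WeierstrassCurve.module_finite_point_holds`) this gives
`3 ≤ E.mordellWeilRank`. Nothing here uses heights or real numbers.

## References
* J. P. Buhler, B. H. Gross, D. B. Zagier, *On the conjecture of Birch and Swinnerton-Dyer for an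
  elliptic curve of rank 3*, Math. Comp. 44 (1985) 473–481, §2. [BuhlerGrossZagier1985]
* J. H. Silverman, *The Arithmetic of Elliptic Curves*, GTM 106, III.2.3 (duplication formula),
  VIII (descent). [SilvermanAEC2009]
-/

namespace Literature.NumberTheory.EllipticCurves.Curve5077a

open WeierstrassCurve WeierstrassCurve.Affine WeierstrassCurve.Affine.Point Polynomial

/-! ## An abstract `2`-descent independence criterion -/

/-- **Independence from a halving obstruction.** In an additive commutative group `M` with no
`2`-torsion, if no non-empty subset sum of `v₀, …, v_{n-1}` is of the form `y + y`, then the `vᵢ`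
are `ℤ`-linearly independent: a primitive relation has an odd coefficient, and reducing it modulo
`2` exhibits a subset sum in `2M` (private helper; the standard descent step). [folklore] -/
private theorem linearIndependent_of_halving_obstruction {M : Type*} [AddCommGroup M] {n : ℕ}
    (v : Fin n → M) (h2 : ∀ x : M, x + x = 0 → x = 0)
    (hS : ∀ r : Fin n → ℤ, (∀ i, r i = 0 ∨ r i = 1) → r ≠ 0 →
      ∀ y : M, ∑ i, r i • v i ≠ y + y) :
    LinearIndependent ℤ v := by
  rw [Fintype.linearIndependent_iff]
  suffices key : ∀ N : ℕ, ∀ g : Fin n → ℤ, ∑ i, (g i).natAbs = N →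
      ∑ i, g i • v i = 0 → ∀ i, g i = 0 by
    intro g hg i
    exact key _ g rfl hg i
  intro N
  induction N using Nat.strong_induction_on with
  | _ N ih =>
    intro g hN hg
    by_contra hne
    push Not at hne
    -- write g = 2 h + r with r ∈ {0,1}
    set r : Fin n → ℤ := fun i => g i % 2 with hr_def
    set h : Fin n → ℤ := fun i => g i / 2 with hh_def
    have hdec : ∀ i, g i = 2 * h i + r i := fun i => by
      simp only [hr_def, hh_def]
      omega
    have hr01 : ∀ i, r i = 0 ∨ r i = 1 := fun i => Int.emod_two_eq_zero_or_one (g i)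
    set Y : M := ∑ i, h i • v i with hY_def
    have hsplit : ∑ i, g i • v i = (Y + Y) + ∑ i, r i • v i := by
      have : ∀ i, g i • v i = (h i • v i + h i • v i) + r i • v i := fun i => by
        rw [hdec i, add_smul, mul_smul, two_smul]
      simp_rw [this, Finset.sum_add_distrib, hY_def]
    by_cases hr0 : r = 0
    · -- all coefficients even: descend
      have hr0' : ∀ i, r i = 0 := fun i => congrFun hr0 i
      have hY : Y + Y = 0 := by
        have := hg
        rw [hsplit] at this
        simpa [hr0'] using this
      have hY0 : Y = 0 := h2 Y hY
      have hg2 : ∀ i, g i = 2 * h i := fun i => by rw [hdec i, hr0' i, add_zero]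
      -- measure of h is smaller
      have hsum : ∑ i, (g i).natAbs = 2 * ∑ i, (h i).natAbs := by
        rw [Finset.mul_sum]
        refine Finset.sum_congr rfl fun i _ => ?_
        rw [hg2 i, Int.natAbs_mul]
        simp
      obtain ⟨i₀, hi₀⟩ := hne
      have hhi₀ : h i₀ ≠ 0 := by
        intro h0
        exact hi₀ (by rw [hg2 i₀, h0, mul_zero])
      have hpos : 0 < ∑ i, (h i).natAbs :=
        Finset.sum_pos' (fun i _ => Nat.zero_le _)
          ⟨i₀, Finset.mem_univ _, Int.natAbs_pos.mpr hhi₀⟩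
      have hlt : ∑ i, (h i).natAbs < N := by omega
      have hzero := ih _ hlt h rfl (by rw [← hY_def]; exact hY0)
      exact hhi₀ (hzero i₀)
    · -- some coefficient odd: the odd part is a subset sum equal to (-Y) + (-Y)
      have hsum0 : (Y + Y) + ∑ i, r i • v i = 0 := by rw [← hsplit]; exact hg
      have heq : ∑ i, r i • v i = (-Y) + (-Y) := by
        have := hsum0
        rw [add_comm] at this
        have h' := eq_neg_of_add_eq_zero_left this
        rw [h', neg_add]
      exact hS r hr01 hr0 (-Y) heq

/-! ## The curve and its points -/

/-- The elliptic curve `5077a` in its global minimal model `y² + y = x³ − 7x + 6`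
(Buhler–Gross–Zagier 1985, eq. (2); `Δ = 5077`, prime conductor `5077`).
[cite: BuhlerGrossZagier1985, §1 eq. (2)] -/
def E : WeierstrassCurve ℚ := ⟨0, 0, 1, -7, 6⟩

/-- `Δ(5077a) = 5077`. [cite: BuhlerGrossZagier1985, §1 eq. (2)] -/
theorem E_Δ : E.Δ = 5077 := by
  norm_num [E, WeierstrassCurve.Δ, WeierstrassCurve.b₂, WeierstrassCurve.b₄,
    WeierstrassCurve.b₆, WeierstrassCurve.b₈]

/-- `5077a` is an elliptic curve (`Δ ≠ 0`). [cite: BuhlerGrossZagier1985, §1 eq. (2)] -/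
instance E_isElliptic : E.IsElliptic := by
  rw [WeierstrassCurve.isElliptic_iff, E_Δ]
  norm_num

/-- `Δ ≠ 0` on the affine model. [cite: BuhlerGrossZagier1985, §1 eq. (2)] -/
theorem E_toAffine_Δ_ne_zero : E.toAffine.Δ ≠ 0 := by
  change E.Δ ≠ 0
  rw [E_Δ]
  norm_num

/-- The coefficients of the affine model. [cite: BuhlerGrossZagier1985, §1 eq. (2)] -/
theorem E_a₁ : E.toAffine.a₁ = 0 := rfl
/-- The coefficients of the affine model. [cite: BuhlerGrossZagier1985, §1 eq. (2)] -/
theorem E_a₂ : E.toAffine.a₂ = 0 := rfl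
/-- The coefficients of the affine model. [cite: BuhlerGrossZagier1985, §1 eq. (2)] -/
theorem E_a₃ : E.toAffine.a₃ = 1 := rfl
/-- The coefficients of the affine model. [cite: BuhlerGrossZagier1985, §1 eq. (2)] -/
theorem E_a₄ : E.toAffine.a₄ = -7 := rfl
/-- The coefficients of the affine model. [cite: BuhlerGrossZagier1985, §1 eq. (2)] -/
theorem E_a₆ : E.toAffine.a₆ = 6 := rfl

/-- `negY` on `5077a`: `-(x,y) = (x, -y-1)` (BGZ p. 476: «the negatives −P = (x, −y − 1)»).
[cite: BuhlerGrossZagier1985, §2 p. 476] -/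
theorem E_negY (x y : ℚ) : E.toAffine.negY x y = -y - 1 := by
  rw [WeierstrassCurve.Affine.negY, E_a₁, E_a₃]; ring

/-- Affine points of `5077a`: `(x,y)` is a (nonsingular) point iff `y² + y = x³ − 7x + 6`.
[cite: BuhlerGrossZagier1985, §1 eq. (2)] -/
theorem E_nonsingular_iff (x y : ℚ) :
    E.toAffine.Nonsingular x y ↔ y ^ 2 + y = x ^ 3 - 7 * x + 6 := by
  rw [← Affine.equation_iff_nonsingular_of_Δ_ne_zero E_toAffine_Δ_ne_zero,
    WeierstrassCurve.Affine.equation_iff]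
  change y ^ 2 + 0 * x * y + 1 * y = x ^ 3 + 0 * x ^ 2 + (-7) * x + 6 ↔ _
  constructor <;> intro h <;> linarith

/-- The point with given coordinates (a helper to name points by their equation).
[cite: BuhlerGrossZagier1985, §2 p. 475] -/
def pt (x y : ℚ) (h : y ^ 2 + y = x ^ 3 - 7 * x + 6) : E.toAffine.Point :=
  .some x y ((E_nonsingular_iff x y).mpr h)

/-- BGZ generator `P₀ = (0, 2)`. [cite: BuhlerGrossZagier1985, §2 p. 475] -/
def P₀ : E.toAffine.Point := pt 0 2 (by norm_num)
/-- BGZ generator `P₁ = (1, 0)`. [cite: BuhlerGrossZagier1985, §2 p. 475] -/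
def P₁ : E.toAffine.Point := pt 1 0 (by norm_num)
/-- BGZ generator `P₂ = (2, 0)`. [cite: BuhlerGrossZagier1985, §2 p. 475] -/
def P₂ : E.toAffine.Point := pt 2 0 (by norm_num)

/-! ## Doubling: the `x`-coordinate of `2R` -/

/-- On `5077a`, if `R = (x,y)` is not `2`-torsion then `x(2R) = ((3x² − 7)/(2y + 1))² − 2x`
(Mathlib's tangent-line addition; Silverman AEC III.2.3(d)). [cite: SilvermanAEC2009, III.2.3] -/
theorem addX_self {x y : ℚ} (hy : y ≠ E.toAffine.negY x y) :
    E.toAffine.addX x x (E.toAffine.slope x x y y) = ((3 * x ^ 2 - 7) / (2 * y + 1)) ^ 2 - 2 * x := by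
  rw [slope_of_Y_ne rfl hy, E_negY, WeierstrassCurve.Affine.addX, E_a₁, E_a₂, E_a₄]
  ring_nf

/-- The halving quartic: if `2R = Q` in `E(ℚ)` with `Q = (x_Q, y_Q)` affine, then `x = x(R)`
satisfies `x⁴ − 4x_Q x³ + 14x² + (28x_Q − 50)x + (49 − 25x_Q) = 0`
(from `x(2R) = x_Q` and `(2y+1)² = 4x³ − 28x + 25`). [cite: SilvermanAEC2009, III.2.3] -/
theorem quartic_of_two_mul_eq {xq yq : ℚ} (hq : E.toAffine.Nonsingular xq yq)
    (R : E.toAffine.Point) (hR : R + R = .some xq yq hq) :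
    ∃ x : ℚ, x ^ 4 - 4 * xq * x ^ 3 + 14 * x ^ 2 + (28 * xq - 50) * x + (49 - 25 * xq) = 0 := by
  rcases R with _ | ⟨x, y, h⟩
  · exact absurd hR (by rw [← Point.zero_def, add_zero]; exact (some_ne_zero hq).symm)
  · by_cases hy : y = E.toAffine.negY x y
    · rw [add_self_of_Y_eq hy] at hR
      exact absurd hR.symm (some_ne_zero hq)
    · rw [add_self_of_Y_ne hy, some.injEq] at hR
      obtain ⟨hX, -⟩ := hR
      rw [addX_self hy] at hX
      have hcurve : y ^ 2 + y = x ^ 3 - 7 * x + 6 := (E_nonsingular_iff x y).mp h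
      have hy' : 2 * y + 1 ≠ 0 := by
        rw [E_negY] at hy
        intro h0; apply hy; linarith
      refine ⟨x, ?_⟩
      field_simp at hX
      linear_combination hX + 4 * (2 * x + xq) * hcurve

/-- A rational root of a monic integer quartic `x⁴ + a x³ + b x² + c x + d` is an integer
(integral root theorem, Mathlib `exists_integer_of_is_root_of_monic`; private helper). [folklore] -/
private theorem int_of_monic_quartic_root (a b c d : ℤ) (x : ℚ)
    (hx : x ^ 4 + a * x ^ 3 + b * x ^ 2 + c * x + d = 0) : ∃ n : ℤ, x = n := by
  let p : ℤ[X] := X ^ 4 + C a * X ^ 3 + C b * X ^ 2 + C c * X + C d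
  have hp : p.Monic := by
    unfold p
    monicity!
  have hr : aeval x p = 0 := by
    simp only [p, map_add, map_mul, map_pow, aeval_X, aeval_C, algebraMap_int_eq,
      Int.coe_castRingHom]
    exact_mod_cast hx
  obtain ⟨n, hn, -⟩ := exists_integer_of_is_root_of_monic hp hr
  exact ⟨n, by rw [hn]; simp⟩

/-- A rational root of a monic integer cubic `u³ + b u + c` is an integer (private helper). [folklore] -/
private theorem int_of_monic_cubic_root (b c : ℤ) (u : ℚ) (hu : u ^ 3 + b * u + c = 0) :
    ∃ n : ℤ, u = n := by
  let p : ℤ[X] := X ^ 3 + C b * X + C c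
  have hp : p.Monic := by
    unfold p
    monicity!
  have hr : aeval u p = 0 := by
    simp only [p, map_add, map_mul, map_pow, aeval_X, aeval_C, algebraMap_int_eq,
      Int.coe_castRingHom]
    exact_mod_cast hu
  obtain ⟨n, hn, -⟩ := exists_integer_of_is_root_of_monic hp hr
  exact ⟨n, by rw [hn]; simp⟩

/-! ## No rational `2`-torsion -/

/-- `E(ℚ)[2] = 0` for `5077a`: `R + R = 0 ⇒ R = 0` (BGZ p. 475: `E(ℚ)` is torsion-free; here only
the `2`-part is needed: `2y + 1 = 0` would make `u = 2x` an integer root of `u³ − 28u + 50`, which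
has no root modulo `3`). [cite: BuhlerGrossZagier1985, §2 p. 475] -/
theorem two_torsion_free (R : E.toAffine.Point) (hR : R + R = 0) : R = 0 := by
  rcases R with _ | ⟨x, y, h⟩
  · rfl
  · exfalso
    by_cases hy : y = E.toAffine.negY x y
    · have hcurve : y ^ 2 + y = x ^ 3 - 7 * x + 6 := (E_nonsingular_iff x y).mp h
      rw [E_negY] at hy
      have hy2 : y = -1 / 2 := by linarith
      have hu : (2 * x) ^ 3 + (-28 : ℤ) * (2 * x) + (50 : ℤ) = 0 := by
        rw [hy2] at hcurve
        push_cast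
        linear_combination (-8) * hcurve
      obtain ⟨n, hn⟩ := int_of_monic_cubic_root (-28) 50 (2 * x) hu
      rw [hn] at hu
      have hz : n ^ 3 + (-28) * n + 50 = 0 := by exact_mod_cast hu
      have h3 := congrArg (Int.cast : ℤ → ZMod 3) hz
      push_cast at h3
      generalize (n : ZMod 3) = t at h3
      revert t
      decide
    · rw [add_self_of_Y_ne hy] at hR
      exact some_ne_zero _ hR

/-! ## The seven subset sums and their halving quartics -/

/-- `P₀ + P₁ = (3, 3)`. [cite: BuhlerGrossZagier1985, §2 Table 1] -/
theorem P₀_add_P₁ : P₀ + P₁ = pt 3 3 (by norm_num) := by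
  rw [P₀, P₁, pt, pt, pt, add_of_X_ne (by norm_num : (0 : ℚ) ≠ 1), some.injEq]
  rw [slope_of_X_ne (by norm_num : (0 : ℚ) ≠ 1)]
  simp only [WeierstrassCurve.Affine.addY, WeierstrassCurve.Affine.negAddY,
    WeierstrassCurve.Affine.addX, WeierstrassCurve.Affine.negY, E_a₁, E_a₂, E_a₃]
  norm_num

/-- `P₀ + P₂ = (-1, -4)`. [cite: BuhlerGrossZagier1985, §2 Table 1] -/
theorem P₀_add_P₂ : P₀ + P₂ = pt (-1) (-4) (by norm_num) := by
  rw [P₀, P₂, pt, pt, pt, add_of_X_ne (by norm_num : (0 : ℚ) ≠ 2), some.injEq]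
  rw [slope_of_X_ne (by norm_num : (0 : ℚ) ≠ 2)]
  simp only [WeierstrassCurve.Affine.addY, WeierstrassCurve.Affine.negAddY,
    WeierstrassCurve.Affine.addX, WeierstrassCurve.Affine.negY, E_a₁, E_a₂, E_a₃]
  norm_num

/-- `P₁ + P₂ = (-3, -1)`. [cite: BuhlerGrossZagier1985, §2 Table 1] -/
theorem P₁_add_P₂ : P₁ + P₂ = pt (-3) (-1) (by norm_num) := by
  rw [P₁, P₂, pt, pt, pt, add_of_X_ne (by norm_num : (1 : ℚ) ≠ 2), some.injEq]
  rw [slope_of_X_ne (by norm_num : (1 : ℚ) ≠ 2)]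
  simp only [WeierstrassCurve.Affine.addY, WeierstrassCurve.Affine.negAddY,
    WeierstrassCurve.Affine.addX, WeierstrassCurve.Affine.negY, E_a₁, E_a₂, E_a₃]
  norm_num

/-- `P₀ + P₁ + P₂ = (4, -7)`. [cite: BuhlerGrossZagier1985, §2 Table 1] -/
theorem P₀_add_P₁_add_P₂ : P₀ + P₁ + P₂ = pt 4 (-7) (by norm_num) := by
  rw [P₀_add_P₁, P₂, pt, pt, pt, add_of_X_ne (by norm_num : (3 : ℚ) ≠ 2), some.injEq]
  rw [slope_of_X_ne (by norm_num : (3 : ℚ) ≠ 2)]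
  simp only [WeierstrassCurve.Affine.addY, WeierstrassCurve.Affine.negAddY,
    WeierstrassCurve.Affine.addX, WeierstrassCurve.Affine.negY, E_a₁, E_a₂, E_a₃]
  norm_num

/-- No point `(x_Q, y_Q)` of `E(ℚ)` with `x_Q ∈ {0, 1, 2, 3, −1, −3, 4}` is twice a rational point:
the halving quartic has no rational root (an integer root would survive modulo `5` or `7`).
This is the exact `2`-descent certificate for the seven non-empty subset sums of `P₀, P₁, P₂`.
[cite: BuhlerGrossZagier1985, §2 p. 475–476] -/
theorem not_two_mul {xq yq : ℚ} (hq : E.toAffine.Nonsingular xq yq)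
    (hx : xq = 0 ∨ xq = 1 ∨ xq = 2 ∨ xq = 3 ∨ xq = -1 ∨ xq = -3 ∨ xq = 4)
    (R : E.toAffine.Point) : R + R ≠ .some xq yq hq := by
  intro hR
  obtain ⟨x, hxroot⟩ := quartic_of_two_mul_eq hq R hR
  rcases hx with rfl | rfl | rfl | rfl | rfl | rfl | rfl
  · -- x_Q = 0: x⁴ + 14x² − 50x + 49, no root mod 5
    obtain ⟨n, rfl⟩ := int_of_monic_quartic_root 0 14 (-50) 49 x (by push_cast; linear_combination hxroot)
    have hz : n ^ 4 + 0 * n ^ 3 + 14 * n ^ 2 + (-50) * n + 49 = 0 := by exact_mod_cast (by linear_combination hxroot : (n:ℚ) ^ 4 + 0 * (n:ℚ) ^ 3 + 14 * (n:ℚ) ^ 2 + (-50) * (n:ℚ) + 49 = 0)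
    have h5 := congrArg (Int.cast : ℤ → ZMod 5) hz
    push_cast at h5
    generalize (n : ZMod 5) = t at h5; revert t; decide
  · -- x_Q = 1: x⁴ − 4x³ + 14x² − 22x + 24, no root mod 7
    obtain ⟨n, rfl⟩ := int_of_monic_quartic_root (-4) 14 (-22) 24 x (by push_cast; linear_combination hxroot)
    have hz : n ^ 4 + (-4) * n ^ 3 + 14 * n ^ 2 + (-22) * n + 24 = 0 := by exact_mod_cast (by linear_combination hxroot : (n:ℚ) ^ 4 + (-4) * (n:ℚ) ^ 3 + 14 * (n:ℚ) ^ 2 + (-22) * (n:ℚ) + 24 = 0)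
    have h7 := congrArg (Int.cast : ℤ → ZMod 7) hz
    push_cast at h7
    generalize (n : ZMod 7) = t at h7; revert t; decide
  · -- x_Q = 2: x⁴ − 8x³ + 14x² + 6x − 1, no root mod 5
    obtain ⟨n, rfl⟩ := int_of_monic_quartic_root (-8) 14 6 (-1) x (by push_cast; linear_combination hxroot)
    have hz : n ^ 4 + (-8) * n ^ 3 + 14 * n ^ 2 + 6 * n + (-1) = 0 := by exact_mod_cast (by linear_combination hxroot : (n:ℚ) ^ 4 + (-8) * (n:ℚ) ^ 3 + 14 * (n:ℚ) ^ 2 + 6 * (n:ℚ) + (-1) = 0)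
    have h5 := congrArg (Int.cast : ℤ → ZMod 5) hz
    push_cast at h5
    generalize (n : ZMod 5) = t at h5; revert t; decide
  · -- x_Q = 3: x⁴ − 12x³ + 14x² + 34x − 26, no root mod 5
    obtain ⟨n, rfl⟩ := int_of_monic_quartic_root (-12) 14 34 (-26) x (by push_cast; linear_combination hxroot)
    have hz : n ^ 4 + (-12) * n ^ 3 + 14 * n ^ 2 + 34 * n + (-26) = 0 := by exact_mod_cast (by linear_combination hxroot : (n:ℚ) ^ 4 + (-12) * (n:ℚ) ^ 3 + 14 * (n:ℚ) ^ 2 + 34 * (n:ℚ) + (-26) = 0)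
    have h5 := congrArg (Int.cast : ℤ → ZMod 5) hz
    push_cast at h5
    generalize (n : ZMod 5) = t at h5; revert t; decide
  · -- x_Q = -1: x⁴ + 4x³ + 14x² − 78x + 74, no root mod 7
    obtain ⟨n, rfl⟩ := int_of_monic_quartic_root 4 14 (-78) 74 x (by push_cast; linear_combination hxroot)
    have hz : n ^ 4 + 4 * n ^ 3 + 14 * n ^ 2 + (-78) * n + 74 = 0 := by exact_mod_cast (by linear_combination hxroot : (n:ℚ) ^ 4 + 4 * (n:ℚ) ^ 3 + 14 * (n:ℚ) ^ 2 + (-78) * (n:ℚ) + 74 = 0)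
    have h7 := congrArg (Int.cast : ℤ → ZMod 7) hz
    push_cast at h7
    generalize (n : ZMod 7) = t at h7; revert t; decide
  · -- x_Q = -3: x⁴ + 12x³ + 14x² − 134x + 124, no root mod 5
    obtain ⟨n, rfl⟩ := int_of_monic_quartic_root 12 14 (-134) 124 x (by push_cast; linear_combination hxroot)
    have hz : n ^ 4 + 12 * n ^ 3 + 14 * n ^ 2 + (-134) * n + 124 = 0 := by exact_mod_cast (by linear_combination hxroot : (n:ℚ) ^ 4 + 12 * (n:ℚ) ^ 3 + 14 * (n:ℚ) ^ 2 + (-134) * (n:ℚ) + 124 = 0)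
    have h5 := congrArg (Int.cast : ℤ → ZMod 5) hz
    push_cast at h5
    generalize (n : ZMod 5) = t at h5; revert t; decide
  · -- x_Q = 4: x⁴ − 16x³ + 14x² + 62x − 51, no root mod 7
    obtain ⟨n, rfl⟩ := int_of_monic_quartic_root (-16) 14 62 (-51) x (by push_cast; linear_combination hxroot)
    have hz : n ^ 4 + (-16) * n ^ 3 + 14 * n ^ 2 + 62 * n + (-51) = 0 := by exact_mod_cast (by linear_combination hxroot : (n:ℚ) ^ 4 + (-16) * (n:ℚ) ^ 3 + 14 * (n:ℚ) ^ 2 + 62 * (n:ℚ) + (-51) = 0)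
    have h7 := congrArg (Int.cast : ℤ → ZMod 7) hz
    push_cast at h7
    generalize (n : ZMod 7) = t at h7; revert t; decide

/-! ## Independence and the rank bound -/

/-- `P₀` is not divisible by `2` in `E(ℚ)`. [cite: BuhlerGrossZagier1985, §2 p. 475] -/
theorem not_two_mul_P₀ (R : E.toAffine.Point) : R + R ≠ P₀ := not_two_mul _ (by norm_num) R
/-- `P₁` is not divisible by `2` in `E(ℚ)`. [cite: BuhlerGrossZagier1985, §2 p. 475] -/
theorem not_two_mul_P₁ (R : E.toAffine.Point) : R + R ≠ P₁ := not_two_mul _ (by norm_num) R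
/-- `P₂` is not divisible by `2` in `E(ℚ)`. [cite: BuhlerGrossZagier1985, §2 p. 475] -/
theorem not_two_mul_P₂ (R : E.toAffine.Point) : R + R ≠ P₂ := not_two_mul _ (by norm_num) R
/-- `P₀ + P₁` is not divisible by `2` in `E(ℚ)`. [cite: BuhlerGrossZagier1985, §2 p. 475] -/
theorem not_two_mul_P₀P₁ (R : E.toAffine.Point) : R + R ≠ P₀ + P₁ := by
  rw [P₀_add_P₁]; exact not_two_mul _ (by norm_num) R
/-- `P₀ + P₂` is not divisible by `2` in `E(ℚ)`. [cite: BuhlerGrossZagier1985, §2 p. 475] -/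
theorem not_two_mul_P₀P₂ (R : E.toAffine.Point) : R + R ≠ P₀ + P₂ := by
  rw [P₀_add_P₂]; exact not_two_mul _ (by norm_num) R
/-- `P₁ + P₂` is not divisible by `2` in `E(ℚ)`. [cite: BuhlerGrossZagier1985, §2 p. 475] -/
theorem not_two_mul_P₁P₂ (R : E.toAffine.Point) : R + R ≠ P₁ + P₂ := by
  rw [P₁_add_P₂]; exact not_two_mul _ (by norm_num) R
/-- `P₀ + P₁ + P₂` is not divisible by `2` in `E(ℚ)`. [cite: BuhlerGrossZagier1985, §2 p. 475] -/
theorem not_two_mul_P₀P₁P₂ (R : E.toAffine.Point) : R + R ≠ P₀ + P₁ + P₂ := by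
  rw [P₀_add_P₁_add_P₂]; exact not_two_mul _ (by norm_num) R

/-- **The BGZ points `P₀ = (0,2)`, `P₁ = (1,0)`, `P₂ = (2,0)` of `5077a` are `ℤ`-linearly
independent** (BGZ 1985 §2: they generate `E(ℚ) ≅ ℤ³`; proved here by the exact `2`-descent
certificate, not by heights). [cite: BuhlerGrossZagier1985, §2 p. 475] -/
theorem linearIndependent_P : LinearIndependent ℤ ![P₀, P₁, P₂] := by
  refine linearIndependent_of_halving_obstruction _ two_torsion_free ?_
  intro r hr01 hr0 y hy
  have h0 := hr01 0; have h1 := hr01 1; have h2 := hr01 2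
  simp only [Fin.sum_univ_three, Matrix.cons_val_zero, Matrix.cons_val_one,
    Matrix.cons_val] at hy
  apply hr0
  rcases h0 with h0 | h0 <;> rcases h1 with h1 | h1 <;> rcases h2 with h2 | h2 <;>
    simp [h0, h1, h2] at hy
  · ext i; fin_cases i <;> simp [h0, h1, h2]
  · exact absurd hy.symm (not_two_mul_P₂ y)
  · exact absurd hy.symm (not_two_mul_P₁ y)
  · exact absurd hy.symm (not_two_mul_P₁P₂ y)
  · exact absurd hy.symm (not_two_mul_P₀ y)
  · exact absurd hy.symm (not_two_mul_P₀P₂ y)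
  · exact absurd hy.symm (not_two_mul_P₀P₁ y)
  · exact absurd hy.symm (not_two_mul_P₀P₁P₂ y)

/-- **`3 ≤ rank_ℤ E(ℚ)` for `5077a`** (BGZ 1985 §2: rank `3`), from `linearIndependent_P` and the
Mordell–Weil theorem (tree theorem `WeierstrassCurve.module_finite_point_holds`). The
`AddCommGroup` structure behind `mordellWeilRank` uses the classical `DecidableEq ℚ`; we transport
along `Subsingleton (DecidableEq ℚ)`. [cite: BuhlerGrossZagier1985, §2 p. 475] -/
theorem three_le_mordellWeilRank : 3 ≤ E.mordellWeilRank := by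
  classical
  haveI : Module.Finite ℤ E.toAffine.Point := by convert E.module_finite_point_holds
  have key := linearIndependent_P.fintype_card_le_finrank
  simp only [Fintype.card_fin] at key
  unfold WeierstrassCurve.mordellWeilRank
  convert key

end Literature.NumberTheory.EllipticCurves.Curve5077a
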